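import Mathlib
import Summits.CriticalPhenomena.CardyFormulaZ2.Theorems.CardySelfRefinementGradientComparabilityStubBoundaryValuesHi
import Summits.CriticalPhenomena.CardyFormulaZ2.Theorems.CardySelfRefinementGradientComparabilityStubBoundaryValuesSkeleton
import Summits.CriticalPhenomena.CardyFormulaZ2.Theorems.CardySelfRefinementGradientComparabilityStubBoundaryValuesCoupling
import Literature.Probability.Percolation.KestenTheoremProofs
import Literature.Probability.Percolation.OpenPathAnnulusCrossing
import Literature.Probability.Percolation.QuadCrossingContinuityReduction
import HarnessLib

/-!
# Boundary value `c = 0` of the self-refinement model: no crossings at small mesh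

Helper file for the stub `stub_boundaryValues` of the line `Sketch` (crux
`stmt-CriticalPhenomena-10269`, `…Theses.CardySelfRefinement.GradientComparability`).

## Mathematics

Under `M_k(ρ, 0)` (`k = 2, 3`) the own coins of interior edges are almost surely off, so the
open edges form a sub-configuration of the axial skeleton (the coarse lattice `kℤ²` subdivided).
If the first quad `Q = F 0` is crossed at mesh `η` (closure semantics: a crossing `K ⊆ [Q]` inside
the open edges drawn at mesh `Δ = η√2`), the open edges drawn through `K` contain an open
lattice walk from a site `u` within `Δ` of `∂₀Q` to a site `w` within `Δ` of `∂₂Q`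
(`openConnIn_of_isPreconnected_subset_openEdgeUnion`); since `dist(∂₀Q, ∂₂Q) = d₀ > 0`, the
walk has `sup`-displacement `≥ (d₀ - 2Δ)/(2Δ) ≥ k(L + 2)` lattice units, `L ≍ d₀/(kΔ)`.  By the
skeleton lemma (`skeleton_arm`) the *coarse shadow* of the coins then has an open arm of
length `L` from a coarse vertex `C` in a box of `O((R₀/(kΔ))²)` vertices (`[Q] ⊆ B(0, R₀)`).  The
coarse shadow is Bernoulli bond percolation with parameter `q(ρ) = ρ̂/2 + (1-ρ̂)/4 ≤ 1/2 - δ/4`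
for `ρ ≤ 1 - δ` (`prodBernoulli_map_coarseShadow`), subcritical by Kesten's theorem, so by
sharpness (`Kesten1980_expDecay`, Menshikov / Aizenman–Barsky / Duminil-Copin–Tassion) and
translation invariance each arm event has probability `≤ e^{-cL}`; the union bound gives
`P k m F η ρ 0 ≤ (2N+1)² e^{-cL} = O(η^{-2}) e^{-c'/η} → 0` uniformly in `ρ ∈ [0, 1 - δ]`.
-/

noncomputable section

namespace Summit.CriticalPhenomena.CardyFormulaZ2.Theorems.CardySelfRefinement

open scoped Topology
open Filter Set MeasureTheory Metric
open Literature.Probability.LatticeModels Literature.Probability.Percolation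
open Literature.Probability.Percolation.QuadCrossing
open Summit.CriticalPhenomena.CardyFormulaZ2.Theses.CardySelfRefinement

/-! ## Geometry of quads and of the drawn lattice -/

/-- Coordinates of a site are bounded by the norm of its complex position. -/
theorem abs_coord_le_norm_toComplex (v : Site 2) :
    |(v 0 : ℝ)| ≤ ‖Site.toComplex v‖ ∧ |(v 1 : ℝ)| ≤ ‖Site.toComplex v‖ :=
  ⟨by simpa [Site.toComplex] using Complex.abs_re_le_norm (Site.toComplex v),
    by simpa [Site.toComplex] using Complex.abs_im_le_norm (Site.toComplex v)⟩

/-- The distance of two drawn sites is at most the mesh times their `ℓ¹` lattice distance. -/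
theorem dist_meshPoint_le_l1 {Δ : ℝ} (hΔ : 0 < Δ) (u w : Site 2) :
    dist (meshPoint Δ u) (meshPoint Δ w) ≤ Δ * (|(u 0 : ℝ) - w 0| + |(u 1 : ℝ) - w 1|) := by
  rw [dist_eq_norm, meshPoint, meshPoint, ← mul_sub, norm_mul, Complex.norm_real, Real.norm_eq_abs,
    abs_of_pos hΔ]
  refine mul_le_mul_of_nonneg_left ?_ hΔ.le
  refine (Complex.norm_le_abs_re_add_abs_im _).trans (le_of_eq ?_)
  simp [Site.toComplex]

/-! ## The skeleton and the coarse arm produced by a crossing -/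

/-- With all interior own coins off, every open edge of `cfg k S` is axial. -/
theorem cfg_skeleton {k : ℕ} {S : Set (Site 2 × Fin 2 × Fin 3)}
    (hS : ∀ e : Site 2 × Fin 2, ¬ IsAxialEdge k e → (e.1, e.2, (0 : Fin 3)) ∉ S) :
    ∀ e ∈ cfg k S, ∃ (v : Site 2) (d : Fin 2),
      e = s(v, v + (if d = 0 then ![1, 0] else ![0, 1])) ∧ (k : ℤ) ∣ v (if d = 0 then 1 else 0) := by
  rintro e ⟨v, d, he, hopn⟩
  refine ⟨v, d, he, ?_⟩
  by_contra hax
  have hax' : ¬ ax k (v, d) := hax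
  simp only [opn, hax', if_false] at hopn
  exact hS (v, d) hax hopn

/-- **A crossing at `c = 0` produces a coarse arm.**  Let all interior own coins of `S` be off and
let the quad `Q` (`[Q] ⊆ B̄(0, R₀)`, opposite sides `d₀` apart) be crossed by `cfg k S` at mesh
`η` (`Δ = η√2`).  If `kL + 2k ≤ (d₀ - 2Δ)/(2Δ)` and `(R₀ + Δ)/(kΔ) + 1 ≤ N`, then the coarse
shadow `edgeConfig (T S)` has an open arm of length `L` from some `C ∈ Λ_N`. -/
theorem exists_arm_of_crossing {k : ℕ} (hk : 2 ≤ k) {S : Set (Site 2 × Fin 2 × Fin 3)}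
    (hS : ∀ e : Site 2 × Fin 2, ¬ IsAxialEdge k e → (e.1, e.2, (0 : Fin 3)) ∉ S)
    (T : Set (Site 2 × Fin 2 × Fin 3) → Set (Site 2 × Fin 2))
    (hT : ∀ S t, t ∈ T S ↔ ((t.1, t.2, (2 : Fin 3)) ∈ S ∧ (t.1, t.2, (1 : Fin 3)) ∈ S) ∨
      ((t.1, t.2, (2 : Fin 3)) ∉ S ∧
        (((![(k : ℤ) * t.1 0, (k : ℤ) * t.1 1] : Site 2), t.2, (0 : Fin 3)) ∈ S ∧
        (((![(k : ℤ) * t.1 0, (k : ℤ) * t.1 1] : Site 2) +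
          (if t.2 = 0 then ![1, 0] else ![0, 1]), t.2, (0 : Fin 3)) ∈ S))))
    (Q : Quad (univ : Set ℂ)) {d₀ R₀ : ℝ} (hd₀ : ∀ a ∈ Q.side 0, ∀ b ∈ Q.side 2, d₀ ≤ dist a b)
    (hR₀ : Q.carrier ⊆ closedBall 0 R₀) {η : ℝ} (hη : 0 < η) {N L : ℕ}
    (hL : (k : ℝ) * L + 2 * k ≤ (d₀ - 2 * (η * Real.sqrt 2)) / (2 * (η * Real.sqrt 2)))
    (hN : (R₀ + η * Real.sqrt 2) / (η * Real.sqrt 2) + k ≤ k * N)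
    (hQ : Q ∈ configOf squareLatticeEmbedding.z η univ (cfg k S)) :
    ∃ C ∈ box 2 N, edgeConfig (T S) ∈ DCT16.armEvent C L := by
  set Δ : ℝ := η * Real.sqrt 2 with hΔdef
  have hΔ : 0 < Δ := by positivity
  have hk0 : (0 : ℝ) < k := by exact_mod_cast (show 0 < k by omega)
  rw [mem_configOf_iff_exists_isCrossing hη (cfg_subset_edgeSet k S)] at hQ
  obtain ⟨K, ⟨hKc, hKconn, hKQ, ⟨a, haK, ha0⟩, ⟨b, hbK, hb2⟩⟩, hKO⟩ := hQ
  -- lattice sites at the two ends, joined by an open walk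
  obtain ⟨p₀, hp₀, h0s⟩ := exists_mem_edgePairs_of_mem hKO haK
  obtain ⟨p₁, hp₁, h1s⟩ := exists_mem_edgePairs_of_mem hKO hbK
  have hconn := openConnIn_of_isPreconnected_subset_openEdgeUnion hΔ hKc hKconn.isPreconnected hKO
    (S := univ) (fun _ _ => mem_univ _) hp₀ hp₁
  have hreach : (openGraph (cfg k S)).Reachable p₀.1 p₁.1 :=
    DCT16.reachable_of_pathIn (DCT16.pathIn_of_mem_openConnIn hconn)
  set u := p₀.1 with hu
  set w := p₁.1 with hw
  have hdu : dist (meshPoint Δ u) a ≤ Δ := dist_meshPoint_le_of_mem_segment hΔ hp₀.1 h0s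
  have hdw : dist (meshPoint Δ w) b ≤ Δ := dist_meshPoint_le_of_mem_segment hΔ hp₁.1 h1s
  have hab : d₀ ≤ dist a b := hd₀ a ha0 b hb2
  have haR : ‖a‖ ≤ R₀ := by simpa using hR₀ (hKQ haK)
  -- the walk is long in the sup norm
  have hfar : (k : ℤ) * L + 2 * k ≤ w 0 - u 0 ∨ (k : ℤ) * L + 2 * k ≤ u 0 - w 0 ∨
      (k : ℤ) * L + 2 * k ≤ w 1 - u 1 ∨ (k : ℤ) * L + 2 * k ≤ u 1 - w 1 := by
    have h1 : d₀ - 2 * Δ ≤ dist (meshPoint Δ u) (meshPoint Δ w) := by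
      linarith [dist_triangle4 a (meshPoint Δ u) (meshPoint Δ w) b, dist_comm (meshPoint Δ u) a]
    have h2 := dist_meshPoint_le_l1 hΔ u w
    have h3 : (d₀ - 2 * Δ) / (2 * Δ) ≤ (|(u 0 : ℝ) - w 0| + |(u 1 : ℝ) - w 1|) / 2 := by
      rw [div_le_div_iff₀ (by positivity) (by norm_num)]
      nlinarith
    have h4 : ((k : ℤ) * L + 2 * k : ℤ) ≤ |(u 0 : ℝ) - w 0| ∨
        ((k : ℤ) * L + 2 * k : ℤ) ≤ |(u 1 : ℝ) - w 1| := by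
      by_contra hcon
      push Not at hcon
      push_cast at hcon
      linarith [hcon.1, hcon.2]
    rcases h4 with h4 | h4
    · have h5 : ((k : ℤ) * L + 2 * k : ℤ) ≤ |u 0 - w 0| := by exact_mod_cast h4
      rcases le_abs'.1 h5 with h6 | h6 <;> omega
    · have h5 : ((k : ℤ) * L + 2 * k : ℤ) ≤ |u 1 - w 1| := by exact_mod_cast h4
      rcases le_abs'.1 h5 with h6 | h6 <;> omega
  obtain ⟨C, C', hCu, hpath, hbox⟩ := skeleton_arm hk (cfg_skeleton hS) (edgeConfig (T S))
    (fun C hC => coarse_mem_shadow_h hk S T hT C hC) (fun C hC => coarse_mem_shadow_v hk S T hT C hC)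
    hreach hfar
  refine ⟨C, ?_, DCT16.armEvent_of_pathIn (edgeConfig_subset_edgeSet _) hpath (Or.inl hbox)⟩
  -- the starting coarse vertex lies in `Λ_N`
  have huR : ‖Site.toComplex u‖ * Δ ≤ R₀ + Δ := by
    have h1 : ‖meshPoint Δ u‖ ≤ R₀ + Δ := by
      have h2 := norm_sub_norm_le (meshPoint Δ u) a
      rw [← dist_eq_norm] at h2
      linarith
    have h3 : ‖meshPoint Δ u‖ = Δ * ‖Site.toComplex u‖ := by
      rw [meshPoint, norm_mul, Complex.norm_real, Real.norm_eq_abs, abs_of_pos hΔ]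
    linarith
  have hB : ‖Site.toComplex u‖ ≤ (R₀ + Δ) / Δ := by rwa [le_div_iff₀ hΔ]
  obtain ⟨hu0, hu1⟩ := abs_coord_le_norm_toComplex u
  obtain ⟨hc0a, hc0b, hc1a, hc1b⟩ := hCu
  have e0a : (k : ℝ) * C 0 - k < u 0 := by exact_mod_cast hc0a
  have e0b : (u 0 : ℝ) < k * C 0 + k := by exact_mod_cast hc0b
  have e1a : (k : ℝ) * C 1 - k < u 1 := by exact_mod_cast hc1a
  have e1b : (u 1 : ℝ) < k * C 1 + k := by exact_mod_cast hc1b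
  rw [abs_le] at hu0 hu1
  have hC0 : (C 0 : ℝ) < N ∧ -(N : ℝ) < C 0 :=
    ⟨lt_of_mul_lt_mul_left (by linarith) hk0.le, lt_of_mul_lt_mul_left (by linarith) hk0.le⟩
  have hC1 : (C 1 : ℝ) < N ∧ -(N : ℝ) < C 1 :=
    ⟨lt_of_mul_lt_mul_left (by linarith) hk0.le, lt_of_mul_lt_mul_left (by linarith) hk0.le⟩
  have i0 : C 0 < N ∧ -(N : ℤ) < C 0 := by exact_mod_cast hC0
  have i1 : C 1 < N ∧ -(N : ℤ) < C 1 := by exact_mod_cast hC1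
  rw [mem_box]
  intro j; fin_cases j <;> simp only [Fin.zero_eta, Fin.mk_one] <;> omega

/-! ## The union bound -/

/-- **The union bound.**  For `k ≥ 2`, every `ρ`, every mesh `η > 0` and integers `N`, `L` as in
`exists_arm_of_crossing` (for the first quad `F 0`), the joint crossing probability under
`M_k(ρ, 0)` is at most `(2N+1)²` times the one-arm probability `P_{q(ρ)}(0 ↔ ∂Λ_L)` of
Bernoulli bond percolation with the coarse-shadow parameter `q(ρ)`. -/
theorem P_zero_le_card_mul {k : ℕ} (hk : 2 ≤ k) {m : ℕ} (F : Fin m → Quad (univ : Set ℂ))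
    (hm : 0 < m) {d₀ R₀ : ℝ}
    (hd₀ : ∀ a ∈ (F ⟨0, hm⟩).side 0, ∀ b ∈ (F ⟨0, hm⟩).side 2, d₀ ≤ dist a b)
    (hR₀ : (F ⟨0, hm⟩).carrier ⊆ closedBall 0 R₀) {η : ℝ} (hη : 0 < η) {N L : ℕ}
    (hL : (k : ℝ) * L + 2 * k ≤ (d₀ - 2 * (η * Real.sqrt 2)) / (2 * (η * Real.sqrt 2)))
    (hN : (R₀ + η * Real.sqrt 2) / (η * Real.sqrt 2) + k ≤ k * N) (ρ : ℝ) :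
    P k m F η ρ 0 ≤ (2 * N + 1 : ℝ) ^ 2 *
      (bondPercolation (zdGraph 2) ⟨_, shadowParam_mem ρ⟩).real (siteToBoundary 2 L) := by
  rw [P_eq_real_preimage k m F hη.ne']
  set μ := prodBernoulli (refinementParam k ρ 0) with hμ
  set T : Set (Site 2 × Fin 2 × Fin 3) → Set (Site 2 × Fin 2) := fun S =>
    {t | ((t.1, t.2, (2 : Fin 3)) ∈ S ∧ (t.1, t.2, (1 : Fin 3)) ∈ S) ∨
      ((t.1, t.2, (2 : Fin 3)) ∉ S ∧
        (((![(k : ℤ) * t.1 0, (k : ℤ) * t.1 1] : Site 2), t.2, (0 : Fin 3)) ∈ S ∧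
        (((![(k : ℤ) * t.1 0, (k : ℤ) * t.1 1] : Site 2) +
          (if t.2 = 0 then ![1, 0] else ![0, 1]), t.2, (0 : Fin 3)) ∈ S)))} with hTdef
  have hT : ∀ S t, t ∈ T S ↔ ((t.1, t.2, (2 : Fin 3)) ∈ S ∧ (t.1, t.2, (1 : Fin 3)) ∈ S) ∨
      ((t.1, t.2, (2 : Fin 3)) ∉ S ∧
        (((![(k : ℤ) * t.1 0, (k : ℤ) * t.1 1] : Site 2), t.2, (0 : Fin 3)) ∈ S ∧
        (((![(k : ℤ) * t.1 0, (k : ℤ) * t.1 1] : Site 2) +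
          (if t.2 = 0 then ![1, 0] else ![0, 1]), t.2, (0 : Fin 3)) ∈ S))) := fun _ _ => Iff.rfl
  set g : Set (Site 2 × Fin 2 × Fin 3) → BondConfig (Site 2) := fun S => edgeConfig (T S) with hg
  have hgm : Measurable g := by
    refine measurable_edgeConfig.comp (measurable_set_iff.2 fun t => ?_)
    exact ((measurable_set_mem _).and (measurable_set_mem _)).or
      ((measurable_set_mem _).not.and ((measurable_set_mem _).and (measurable_set_mem _)))
  have hincl : ∀ᵐ S ∂μ, S ∈ cfg k ⁻¹' Aloc m F η → S ∈ ⋃ C ∈ box 2 N, g ⁻¹' DCT16.armEvent C L := by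
    filter_upwards [ae_forall_interior_notMem k ρ] with S hS hA
    rw [mem_preimage, cfg_mem_Aloc_iff] at hA
    obtain ⟨C, hC, harm⟩ :=
      exists_arm_of_crossing hk hS T hT (F ⟨0, hm⟩) hd₀ hR₀ hη hL hN (hA ⟨0, hm⟩)
    exact mem_biUnion hC harm
  calc μ.real (cfg k ⁻¹' Aloc m F η)
      ≤ μ.real (⋃ C ∈ box 2 N, g ⁻¹' DCT16.armEvent C L) :=
        ENNReal.toReal_mono (measure_ne_top _ _) (measure_mono_ae hincl)
    _ ≤ ∑ C ∈ box 2 N, μ.real (g ⁻¹' DCT16.armEvent C L) := measureReal_biUnion_finset_le _ _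
    _ ≤ ∑ C ∈ box 2 N,
          (bondPercolation (zdGraph 2) ⟨_, shadowParam_mem ρ⟩).real (siteToBoundary 2 L) := by
        refine Finset.sum_le_sum fun C _ => ?_
        calc μ.real (g ⁻¹' DCT16.armEvent C L) ≤ (μ.map g).real (DCT16.armEvent C L) :=
              ENNReal.toReal_mono (measure_ne_top _ _) (Measure.le_map_apply hgm.aemeasurable _)
          _ = (bondPercolation (zdGraph 2) ⟨_, shadowParam_mem ρ⟩).real (DCT16.armEvent C L) := by
              rw [hμ, hg, prodBernoulli_map_coarseShadow hk ρ 0 T hT]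
          _ = _ := DCT16.real_armEvent _ C L
    _ = (2 * N + 1 : ℝ) ^ 2 *
          (bondPercolation (zdGraph 2) ⟨_, shadowParam_mem ρ⟩).real (siteToBoundary 2 L) := by
        rw [Finset.sum_const, card_box, nsmul_eq_mul]
        push_cast
        ring

/-! ## `P k m F η ρ 0 → 0` uniformly in `ρ ≤ 1 - δ` -/

/-- `x² e^{-κx} → 0` as `x → ∞` (`κ > 0`). -/
theorem tendsto_sq_mul_exp_neg {κ : ℝ} (hκ : 0 < κ) :
    Tendsto (fun x : ℝ => x ^ 2 * Real.exp (-κ * x)) atTop (𝓝 0) := by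
  have h1 := (Real.tendsto_pow_mul_exp_neg_atTop_nhds_zero 2).comp
    (tendsto_id.const_mul_atTop hκ)
  have h2 := h1.const_mul ((κ⁻¹) ^ 2)
  rw [mul_zero] at h2
  refine h2.congr fun x => ?_
  simp only [Function.comp_apply, id]
  field_simp

/-- **The integers `N`, `L` of the union bound** at mesh `η ≤ 1` (`Δ = η√2`, `Δ(4k+2) ≤ d₀`):
`N = ⌈(R₀ + Δ)/(kΔ)⌉ + 1`, `L = ⌊(d₀ - 2Δ)/(2kΔ) - 2⌋`, with the bounds `2N + 1 ≤ (a + 6)/η`,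
`L ≥ b/η - 4`, `a = 2R₀/(k√2)`, `b = d₀/(2k√2)`. -/
theorem exists_N_L {k : ℕ} (hk : 2 ≤ k) {R₀ d₀ η : ℝ} (hR₀ : 0 ≤ R₀) (hη : 0 < η) (hη1 : η ≤ 1)
    (hd : η * (Real.sqrt 2 * (4 * k + 2)) ≤ d₀) :
    ∃ N L : ℕ, (k : ℝ) * L + 2 * k ≤ (d₀ - 2 * (η * Real.sqrt 2)) / (2 * (η * Real.sqrt 2)) ∧
      (R₀ + η * Real.sqrt 2) / (η * Real.sqrt 2) + k ≤ k * N ∧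
      (2 * N + 1 : ℝ) ≤ (2 * R₀ / (k * Real.sqrt 2) + 6) * η⁻¹ ∧
      d₀ / (2 * k * Real.sqrt 2) * η⁻¹ - 4 ≤ L := by
  have hk0 : (0 : ℝ) < k := by exact_mod_cast (show 0 < k by omega)
  have hk2' : (2 : ℝ) ≤ k := by exact_mod_cast hk
  have hs : 0 < Real.sqrt 2 := Real.sqrt_pos.2 (by norm_num)
  set Δ : ℝ := η * Real.sqrt 2 with hΔ
  have hΔ0 : 0 < Δ := by positivity
  set y : ℝ := (d₀ - 2 * Δ) / (2 * k * Δ) - 2 with hy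
  have hy0 : 0 ≤ y := by
    rw [hy, sub_nonneg, le_div_iff₀ (by positivity)]
    nlinarith
  have hLy : (⌊y⌋₊ : ℝ) ≤ y := Nat.floor_le hy0
  have hyL : y < ⌊y⌋₊ + 1 := Nat.lt_floor_add_one y
  have hceil := Nat.le_ceil ((R₀ + Δ) / (k * Δ))
  have hceil' := Nat.ceil_lt_add_one (show 0 ≤ (R₀ + Δ) / (k * Δ) by positivity)
  refine ⟨⌈(R₀ + Δ) / (k * Δ)⌉₊ + 1, ⌊y⌋₊, ?_, ?_, ?_, ?_⟩
  · have h3 : (k : ℝ) * ⌊y⌋₊ ≤ k * y := mul_le_mul_of_nonneg_left hLy hk0.le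
    have h4 : (k : ℝ) * y + 2 * k = (d₀ - 2 * Δ) / (2 * Δ) := by
      rw [hy]; field_simp; ring
    linarith
  · have h3 : (R₀ + Δ) / Δ = k * ((R₀ + Δ) / (k * Δ)) := by field_simp
    rw [h3]
    push_cast
    nlinarith
  · have h4 : (R₀ + Δ) / (k * Δ) = 2 * R₀ / (k * Real.sqrt 2) * η⁻¹ / 2 + 1 / k := by
      rw [hΔ]; field_simp
    have h5 : (1 : ℝ) / k ≤ 1 / 2 := by
      rw [div_le_div_iff₀ hk0 (by norm_num)]; linarith
    have h6 : (1 : ℝ) ≤ η⁻¹ := one_le_inv_iff₀.2 ⟨hη, hη1⟩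
    push_cast
    linarith
  · have h3 : y = d₀ / (2 * k * Real.sqrt 2) * η⁻¹ - 1 / k - 2 := by
      rw [hy, hΔ]; field_simp
    have h5 : (1 : ℝ) / k ≤ 1 := by rw [div_le_one hk0]; linarith
    linarith

/-- **Boundary value `c = 0`.**  For `k = 2, 3`, a nonempty quad family, `0 < δ ≤ 1/2` and
`v > 0`: for every mesh `η` below a threshold depending only on these data, the joint crossing
probability under `M_k(ρ, 0)` is `< v` for every `ρ ∈ [0, 1 - δ]`. -/
theorem P_zero_lt_eventually {k : ℕ} (hk : k = 2 ∨ k = 3) {m : ℕ}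
    (F : Fin m → Quad (univ : Set ℂ)) (hm : 0 < m) {δ : ℝ} (hδ : 0 < δ) (hδ2 : δ ≤ 1 / 2)
    {v : ℝ} (hv : 0 < v) :
    ∀ᶠ η in 𝓝[>] (0 : ℝ), ∀ ρ ∈ Icc (0 : ℝ) (1 - δ), P k m F η ρ 0 < v := by
  have hk2 : 2 ≤ k := by rcases hk with rfl | rfl <;> norm_num
  have hk0 : (0 : ℝ) < k := by exact_mod_cast (show 0 < k by omega)
  obtain ⟨d₀, hd₀pos, hd₀'⟩ := (F ⟨0, hm⟩).exists_pos_le_dist_side_side_add_two 0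
  have hd₀ : ∀ a ∈ (F ⟨0, hm⟩).side 0, ∀ b ∈ (F ⟨0, hm⟩).side 2, d₀ ≤ dist a b := by
    simpa using hd₀'
  obtain ⟨R₀, hR₀⟩ := (F ⟨0, hm⟩).isCompact_carrier.isBounded.subset_closedBall 0
  have hR₀nn : 0 ≤ R₀ := by
    have h : (F ⟨0, hm⟩) (0, 0) ∈ closedBall (0 : ℂ) R₀ := hR₀ ⟨(0, 0), rfl⟩
    rw [mem_closedBall] at h
    exact dist_nonneg.trans h
  -- the subcritical comparison parameter `1/2 - δ/4`
  set qs : unitInterval := ⟨1 / 2 - δ / 4, by constructor <;> linarith⟩ with hqs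
  obtain ⟨c, hc, hdecay⟩ := Kesten1980_expDecay qs (by rw [hqs]; linarith)
  -- constants of the numeric bounds `2N + 1 ≤ (a + 6)/η`, `L ≥ b/η - 4`
  set a : ℝ := 2 * R₀ / (k * Real.sqrt 2) with ha
  set b : ℝ := d₀ / (2 * k * Real.sqrt 2) with hb
  have ha0 : 0 ≤ a := by positivity
  have hb0 : 0 < b := by positivity
  set ε' : ℝ := v / (Real.exp (4 * c) * (a + 6) ^ 2) with hε'
  have hε'0 : 0 < ε' := by positivity
  have hev1 : ∀ᶠ η in 𝓝[>] (0 : ℝ), (η⁻¹) ^ 2 * Real.exp (-(c * b) * η⁻¹) < ε' :=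
    tendsto_inv_nhdsGT_zero.eventually
      ((tendsto_sq_mul_exp_neg (mul_pos hc hb0)).eventually (gt_mem_nhds hε'0))
  have hev2 : ∀ᶠ η in 𝓝[>] (0 : ℝ), η < min 1 (d₀ / (Real.sqrt 2 * (4 * k + 2))) :=
    (gt_mem_nhds (by positivity)).filter_mono nhdsWithin_le_nhds
  filter_upwards [hev1, hev2, self_mem_nhdsWithin] with η h1 h2 hη0 ρ hρ
  have hη0 : 0 < η := hη0
  rw [lt_min_iff, lt_div_iff₀ (by positivity)] at h2
  obtain ⟨N, L, hLhyp, hNhyp, hN', hL'⟩ := exists_N_L hk2 hR₀nn hη0 h2.1.le h2.2.le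
  have hP := P_zero_le_card_mul hk2 F hm hd₀ hR₀ hη0 hLhyp hNhyp ρ
  -- the Bernoulli factor
  have hq : (⟨_, shadowParam_mem ρ⟩ : unitInterval) ≤ qs := by
    rw [hqs, Subtype.mk_le_mk, Set.projIcc_of_mem _ ⟨hρ.1, by linarith [hρ.2]⟩]
    linarith [hρ.2]
  have hbern : (bondPercolation (zdGraph 2) ⟨_, shadowParam_mem ρ⟩).real (siteToBoundary 2 L) ≤
      Real.exp (-c * L) :=
    (DCT16.real_mono_of_isUpperSet _ (DCT16.isUpperSet_siteToBoundary 2 L)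
      (DCT16.measurableSet_siteToBoundary 2 L) hq).trans (hdecay L)
  have hexp : Real.exp (-c * L) ≤ Real.exp (4 * c) * Real.exp (-(c * b) * η⁻¹) := by
    rw [← Real.exp_add, Real.exp_le_exp]
    have := mul_le_mul_of_nonneg_left hL' hc.le
    linarith
  have hsq : (2 * N + 1 : ℝ) ^ 2 ≤ (a + 6) ^ 2 * (η⁻¹) ^ 2 := by
    rw [← mul_pow]
    exact pow_le_pow_left₀ (by positivity) hN' 2
  have hfin : Real.exp (4 * c) * (a + 6) ^ 2 * ε' = v := by
    rw [hε']; field_simp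
  calc P k m F η ρ 0 ≤ (2 * N + 1 : ℝ) ^ 2 *
        (bondPercolation (zdGraph 2) ⟨_, shadowParam_mem ρ⟩).real (siteToBoundary 2 L) := hP
    _ ≤ ((a + 6) ^ 2 * (η⁻¹) ^ 2) * (Real.exp (4 * c) * Real.exp (-(c * b) * η⁻¹)) :=
        mul_le_mul hsq (hbern.trans hexp) measureReal_nonneg (by positivity)
    _ = Real.exp (4 * c) * (a + 6) ^ 2 * ((η⁻¹) ^ 2 * Real.exp (-(c * b) * η⁻¹)) := by ring
    _ < Real.exp (4 * c) * (a + 6) ^ 2 * ε' := by gcongr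
    _ = v := hfin

end Summit.CriticalPhenomena.CardyFormulaZ2.Theorems.CardySelfRefinement

end
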